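import Mathlib
import Literature.RingTheory.CohomologyAnnihilator.ReductionModRegular
import Literature.RingTheory.CohomologyAnnihilator.SyzygyDescent
import Literature.RingTheory.CohomologyAnnihilator.Localization
import Summits.ResolutionOfSingularities.ResolutionOfSingularities.Theorems.HomologicalConductorNoZenoStableAnnihilatorReduction
import HarnessLib

/-!
# Crux `Persistence` (stmt-ResolutionOfSingularities-16484) / rung S-2 — DESCENT of the cohomology annihilator along a branched
# cover: `π(caⁿ(R♯)) ⊆ caⁿ⁻¹(R♯/(y))` — the UPPER half of THEOREM DP / Esentepe 2020 Thm 5.4, fact-free and MF-free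

Route `ResolutionOfSingularities/HomologicalConductor`, chain W4.4b (cell `res-hironaka`).  `[OURS · L1 w44b · res-L1-w44b-stub-2 gen 4,
memo `L/res-L1-w44b-stub-2/DESCENT-BLUEPRINT.md`]`; NOT a statement of the manuscript under review (Hironaka 2017), no statement of that
manuscript is used; AI-written, weaker than expert review.

## Setting and statement (`map_cohomologyAnnihilatorOfDegree_le`)

`S → R♯` commutative rings (`Algebra S R♯`), `R♯` noetherian, `y ∈ R♯` a non-zero-divisor, and two `S`-linear «coefficient» maps
`ε λ : R♯ → S` with  (A1) `r − ε(r)·1 ∈ (y)`  and  (A2) `λ(y·r) = ε(r)`  for all `r` — e.g. the `m`-BRANCHED COVER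
`R♯ = S[y]/(yᵐ + f)` (`m ≥ 2`) with `ε, λ` = the coefficients of `1` and `y` in the `S`-basis `1, y, …, y^{m−1}`.  Put `R̄ = R♯/(y)`
(`≅ S/(f)` in the example).  THEN for every `n ≥ 2`:  **`(caⁿ(R♯)).map (R♯ → R̄) ≤ caⁿ⁻¹(R̄)`**.  No regularity of `S`, no characteristic
hypothesis, no matrix factorisation.  (The LOWER half `(ca R̄).comap ≤ ca R♯` for `y ∈ ca(R♯)` is `…PersistenceQuotientAscent`, p531707.)

## Proof

KNÖRRER'S LEMMA (i) IN ONE LINE.  Let `M̄` be a finitely generated `R̄`-module, `M` its restriction to `R♯` (`yM = 0`), `F = R♯ᵐ ↠ M` with kernel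
`K₁`.  Then `M̄` is a RETRACT of `K₁/yK₁` over `R̄` (`isRetract_quot_ker`): `i(π v) = [y v]`, `r[k] = Σⱼ λ(kⱼ)·π(eⱼ)`; `r` is `R♯`-linear by
(A1)–(A2) and `yM = 0`, kills `yK₁` because `Σⱼ ε(vⱼ)·π(eⱼ) = π(v)` (A1), and `r ∘ i = id` by (A2).  (For `S[y]/(y²+f)`:
`K₁/yK₁ ≅ M ⊕ Ω_R M` — we only need the retract.)
DESCENT.  `c ∈ caⁿ(R♯)`; `K` an `(n−2)`-th syzygy of `K₁` is an `(n−1)`-th syzygy of `M`, so `c` stably annihilates `K` (CA1); `y` is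
`K₁`-regular, so `K/yK` is an `(n−2)`-th `R̄`-syzygy of `K₁/yK₁` [DaoTakahashi 5.6, tree `IsSyzygy.quotSMulTop`] and `c̄` stably annihilates
`K/yK` (reduce the factorisation mod `y`); hence `c̄` kills `Ext^{≥ n−1}_{R̄}(K₁/yK₁, −)` (dimension shift), hence `Ext^{≥ n−1}_{R̄}(M̄, −)`
(retract); `M̄` arbitrary ⇒ `c̄ ∈ caⁿ⁻¹(R̄)`.

References (mechanism only): H. Knörrer, Invent. Math. 88 (1987) (Lemma (i)); Ö. Esentepe, J. Algebra 541 (2020) Thm 5.4 / Lemma 5.2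
[`Esentepe2020`]; H. Dao, R. Takahashi, ANT 8 (2014) Lemma 5.6 [`DaoTakahashi2014`]; S. B. Iyengar, R. Takahashi, IMRN 2016 §2
[`IyengarTakahashi2014`].
-/

noncomputable section

-- single-problem summit: the doubled namespace component `ResolutionOfSingularities` is forced
set_option linter.dupNamespace false

namespace Summit.ResolutionOfSingularities.ResolutionOfSingularities.Theorems.HomologicalConductor.DoubleCoverDescent

open CategoryTheory CategoryTheory.Abelian Literature.RingTheory.CohomologyAnnihilator
open Summit.ResolutionOfSingularities.ResolutionOfSingularities.Theorems.NoZeno.SandwichCluster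
open scoped Pointwise nonZeroDivisors

universe u

variable {T : Type u} [CommRing T]

/-! ## §1 Stable annihilation reduces modulo `y` -/

/-- If `c` stably annihilates `X` over `T` then `c̄` stably annihilates `X/yX` over `T/(y)` (reduce the factorisation through a
finitely generated projective modulo `y`). [folklore] -/
theorem stablyAnnihilates_quotSMulTop (y c : T) {X : ModuleCat.{u} T} [Module.Finite T X] (h : StablyAnnihilates T c X) :
    StablyAnnihilates (T ⧸ Ideal.span {y}) (Ideal.Quotient.mk (Ideal.span {y}) c)
      (ModuleCat.of (T ⧸ Ideal.span {y}) (X ⧸ (y • ⊤ : Submodule T X))) := by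
  obtain ⟨P, hPfin, hPproj, ι, π, hιπ⟩ := h
  haveI := hPfin
  obtain ⟨ιq, hιq⟩ := exists_hom_quotSMulTop y ι.hom
  obtain ⟨πq, hπq⟩ := exists_hom_quotSMulTop y π.hom
  haveI : Module.Finite (T ⧸ Ideal.span {y}) (ModuleCat.of (T ⧸ Ideal.span {y}) (P ⧸ (y • ⊤ : Submodule T P))) :=
    Module.Finite.of_restrictScalars_finite T _ _
  refine ⟨ModuleCat.of _ (P ⧸ (y • ⊤ : Submodule T P)), inferInstance, projective_quotSMulTop y P hPproj, ιq, πq, ?_⟩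
  apply ModuleCat.hom_ext
  refine LinearMap.ext fun z => ?_
  induction z using Submodule.Quotient.induction_on with
  | _ x =>
    change πq (ιq (Submodule.Quotient.mk x)) = Ideal.Quotient.mk (Ideal.span {y}) c • Submodule.Quotient.mk x
    rw [hιq, hπq, apply_apply_eq_smul_of_comp_eq_smul_id hιπ x]
    rfl

/-! ## §2 Knörrer's lemma (i), retract form -/

section Knorrer

variable {S : Type u} [CommRing S] [Algebra S T]

/-- `Σⱼ ε(vⱼ) • π(eⱼ) = π(v)` for an `R♯`-linear `π : R♯ᵐ → M` into a module killed by `y`, when `r − ε(r)·1 ∈ (y)`. [folklore] -/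
theorem sum_eps_smul_eq (y : T) (ε : T →ₗ[S] S) (hA1 : ∀ r : T, r - algebraMap S T (ε r) ∈ Ideal.span {y})
    {M : Type u} [AddCommGroup M] [Module T M] [Module S M] [IsScalarTower S T M] (hyM : ∀ m : M, y • m = 0) {m : ℕ}
    (π : (Fin m → T) →ₗ[T] M) (v : Fin m → T) :
    (∑ j, ε (v j) • π (Pi.single j 1)) = π v := by
  have hv : π v = ∑ j, v j • π (Pi.single j 1) := by
    conv_lhs => rw [pi_eq_sum_univ v]
    simp only [map_sum]
    refine Finset.sum_congr rfl fun j _ => ?_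
    rw [show (v j • fun i => if j = i then (1 : T) else 0) = v j • (Pi.single j 1 : Fin m → T) by
      ext i; simp [Pi.single_apply, eq_comm], map_smul]
  rw [hv]
  refine Finset.sum_congr rfl fun j _ => ?_
  obtain ⟨r', hr'⟩ := Ideal.mem_span_singleton'.mp (hA1 (v j))
  have hvj : v j = algebraMap S T (ε (v j)) + r' * y := by rw [hr']; ring
  have : v j • π (Pi.single j 1) = algebraMap S T (ε (v j)) • π (Pi.single j 1) + r' • (y • π (Pi.single j 1)) := by
    rw [← mul_smul, ← add_smul, ← hvj]
  rw [this, hyM, smul_zero, add_zero, algebraMap_smul]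

/-- **Knörrer's lemma (i), retract form.** `y ∈ R♯`, `ε λ : R♯ → S` `S`-linear with (A1) `r − ε(r)·1 ∈ (y)` and (A2) `λ(y r) = ε(r)`;
`M̄` a finitely generated `R̄ = R♯/(y)`-module, `M` its restriction to `R♯`, `π : R♯ᵐ ↠ M` a free cover with kernel `K₁`.  Then `M̄` is a
retract of `K₁/yK₁` over `R̄`: there are `R̄`-linear `i : M̄ → K₁/yK₁`, `r : K₁/yK₁ → M̄` with `r ∘ i = id`. [OURS · mechanism Knörrer 1987] -/
theorem isRetract_quot_ker (y : T) (ε «λ» : T →ₗ[S] S) (hA1 : ∀ r : T, r - algebraMap S T (ε r) ∈ Ideal.span {y})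
    (hA2 : ∀ r : T, «λ» (y * r) = ε r) (Mbar : ModuleCat.{u} (T ⧸ Ideal.span {y})) {m : ℕ}
    (π : (Fin m → T) →ₗ[T] ((restrictScalarsFunctor T (T ⧸ Ideal.span {y})).obj Mbar)) (hπ : Function.Surjective π) :
    ∃ (i : Mbar ⟶ ModuleCat.of (T ⧸ Ideal.span {y})
          (LinearMap.ker π ⧸ (y • ⊤ : Submodule T (LinearMap.ker π))))
      (r : ModuleCat.of (T ⧸ Ideal.span {y}) (LinearMap.ker π ⧸ (y • ⊤ : Submodule T (LinearMap.ker π))) ⟶ Mbar),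
      i ≫ r = 𝟙 Mbar := by
  classical
  let M := (restrictScalarsFunctor T (T ⧸ Ideal.span {y})).obj Mbar
  haveI : IsScalarTower T (T ⧸ Ideal.span {y}) M := IsScalarTower.of_algebraMap_smul fun _ _ => rfl
  letI : Module S M := Module.compHom M (algebraMap S T)
  haveI : IsScalarTower S T M := IsScalarTower.of_algebraMap_smul fun _ _ => rfl
  have hyM : ∀ x : M, y • x = 0 := fun x => by
    have : (algebraMap T (T ⧸ Ideal.span {y}) y) • x = y • x := rfl
    rw [← this, show algebraMap T (T ⧸ Ideal.span {y}) y = 0 from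
      Ideal.Quotient.eq_zero_iff_mem.mpr (Ideal.mem_span_singleton_self y), zero_smul]
  set K₁ : Submodule T (Fin m → T) := LinearMap.ker π with hK₁
  -- `r̃ : K₁ → M`, `k ↦ Σⱼ λ(kⱼ) • π(eⱼ)`, is `R♯`-linear
  have hlin : ∀ (s : T) (k : Fin m → T), k ∈ K₁ →
      (∑ j, «λ» ((s • k) j) • π (Pi.single j 1)) = s • ∑ j, «λ» (k j) • π (Pi.single j 1) := by
    intro s k hk
    obtain ⟨s', hs'⟩ := Ideal.mem_span_singleton'.mp (hA1 s)
    -- `s = ε(s) + s' y`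
    have hs : s = algebraMap S T (ε s) + s' * y := by rw [hs']; ring
    have hterm : ∀ j, «λ» ((s • k) j) = ε s * «λ» (k j) + ε ((s' • k) j) := fun j => by
      have h1 : (s • k) j = (ε s) • k j + y * ((s' • k) j) := by
        rw [Pi.smul_apply, smul_eq_mul, Pi.smul_apply, smul_eq_mul, Algebra.smul_def]
        conv_lhs => rw [hs]
        ring
      rw [h1, map_add, LinearMap.map_smul, smul_eq_mul, hA2]
    simp_rw [hterm, add_smul, Finset.sum_add_distrib, mul_smul, ← Finset.smul_sum]
    rw [sum_eps_smul_eq y ε hA1 hyM π (s' • k), map_smul, show π k = 0 from hk, smul_zero, add_zero]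
    conv_rhs => rw [hs]
    rw [add_smul, algebraMap_smul, mul_comm s' y, mul_smul, hyM, add_zero]
  let r₀ : K₁ →ₗ[T] M :=
    { toFun := fun k => ∑ j, «λ» ((k : Fin m → T) j) • π (Pi.single j 1)
      map_add' := fun k k' => by
        simp only [Submodule.coe_add, Pi.add_apply, map_add, add_smul, Finset.sum_add_distrib]
      map_smul' := fun s k => by
        rw [RingHom.id_apply, Submodule.coe_smul]
        exact hlin s k k.2 }
  have hr₀ : ∀ k : K₁, r₀ k = ∑ j, «λ» ((k : Fin m → T) j) • π (Pi.single j 1) := fun k => rfl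
  -- `r₀` kills `yK₁`
  have hr₀y : (y • ⊤ : Submodule T K₁) ≤ LinearMap.ker r₀ := by
    intro k hk
    obtain ⟨k', -, rfl⟩ := (Submodule.mem_smul_pointwise_iff_exists _ _ _).1 hk
    rw [LinearMap.mem_ker, hr₀]
    have : ∀ j, «λ» (((y • k' : K₁) : Fin m → T) j) = ε ((k' : Fin m → T) j) := fun j => by
      rw [Submodule.coe_smul, Pi.smul_apply, smul_eq_mul, hA2]
    simp_rw [this]
    rw [sum_eps_smul_eq y ε hA1 hyM π]
    exact k'.2
  let r₁ : (K₁ ⧸ (y • ⊤ : Submodule T K₁)) →ₗ[T] M := (y • ⊤ : Submodule T K₁).liftQ r₀ hr₀y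
  -- `i₀ : M → K₁/yK₁`, `π v ↦ [y v]`
  have hyv : ∀ v : Fin m → T, y • v ∈ K₁ := fun v => by
    rw [hK₁, LinearMap.mem_ker, map_smul, hyM]
  let j₀ : (Fin m → T) →ₗ[T] (K₁ ⧸ (y • ⊤ : Submodule T K₁)) :=
    (y • ⊤ : Submodule T K₁).mkQ ∘ₗ (LinearMap.codRestrict K₁ (y • LinearMap.id) (fun v => hyv v))
  have hj₀ : ∀ v, j₀ v = Submodule.Quotient.mk ⟨y • v, hyv v⟩ := fun v => rfl
  have hj₀K : K₁ ≤ LinearMap.ker j₀ := fun v hv => by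
    rw [LinearMap.mem_ker, hj₀, Submodule.Quotient.mk_eq_zero]
    exact Submodule.smul_mem_pointwise_smul _ _ _ (Submodule.mem_top : (⟨v, hv⟩ : K₁) ∈ ⊤)
  let i₀ : M →ₗ[T] (K₁ ⧸ (y • ⊤ : Submodule T K₁)) :=
    (K₁.liftQ j₀ hj₀K) ∘ₗ (π.quotKerEquivOfSurjective hπ).symm.toLinearMap
  have hi₀ : ∀ v, i₀ (π v) = Submodule.Quotient.mk ⟨y • v, hyv v⟩ := fun v => by
    change K₁.liftQ j₀ hj₀K ((π.quotKerEquivOfSurjective hπ).symm (π v)) = _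
    have : (π.quotKerEquivOfSurjective hπ).symm (π v) = Submodule.Quotient.mk v :=
      (LinearEquiv.symm_apply_eq _).mpr rfl
    rw [this, Submodule.liftQ_apply, hj₀]
  -- `r₁ (i₀ (π v)) = π v`
  have hri : ∀ x : M, r₁ (i₀ x) = x := fun x => by
    obtain ⟨v, rfl⟩ := hπ x
    rw [hi₀, Submodule.liftQ_apply, hr₀]
    have : ∀ j, «λ» (((⟨y • v, hyv v⟩ : K₁) : Fin m → T) j) = ε (v j) := fun j => by
      change «λ» ((y • v) j) = _
      rw [Pi.smul_apply, smul_eq_mul, hA2]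
    simp_rw [this]
    exact sum_eps_smul_eq y ε hA1 hyM π v
  -- extend scalars to `R̄`
  haveI : IsScalarTower T (T ⧸ Ideal.span {y}) (K₁ ⧸ (y • ⊤ : Submodule T K₁)) := isScalarTower_quotSMulTop y K₁
  let i₁ : M →ₗ[T ⧸ Ideal.span {y}] (K₁ ⧸ (y • ⊤ : Submodule T K₁)) :=
    LinearMap.extendScalarsOfSurjective (algebraMap_quotient_surjective _) i₀
  let r₂ : (K₁ ⧸ (y • ⊤ : Submodule T K₁)) →ₗ[T ⧸ Ideal.span {y}] M :=
    LinearMap.extendScalarsOfSurjective (algebraMap_quotient_surjective _) r₁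
  refine ⟨ModuleCat.ofHom (X := Mbar) (Y := ModuleCat.of (T ⧸ Ideal.span {y}) (K₁ ⧸ (y • ⊤ : Submodule T K₁))) i₁,
    ModuleCat.ofHom (X := ModuleCat.of (T ⧸ Ideal.span {y}) (K₁ ⧸ (y • ⊤ : Submodule T K₁))) (Y := Mbar) r₂, ?_⟩
  apply ModuleCat.hom_ext
  exact LinearMap.ext fun x => hri x

end Knorrer

/-! ## §3 Descent -/

/-- **DESCENT of the cohomology annihilator along `y`** (the upper half of Esentepe 2020 Thm 5.4 / THEOREM DP, MF-free): `R♯`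
noetherian, `y ∈ R♯⁰`, `ε λ : R♯ → S` `S`-linear with (A1) `r − ε(r)·1 ∈ (y)`, (A2) `λ(y r) = ε(r)`.  Then for `n ≥ 2` and
`c ∈ caⁿ(R♯)`: `c̄ ∈ caⁿ⁻¹(R♯/(y))`. [OURS · L1 w44b] -/
theorem mk_mem_cohomologyAnnihilatorOfDegree [IsNoetherianRing T] {S : Type u} [CommRing S] [Algebra S T] {y : T} (hy : y ∈ T⁰)
    (ε «λ» : T →ₗ[S] S) (hA1 : ∀ r : T, r - algebraMap S T (ε r) ∈ Ideal.span {y}) (hA2 : ∀ r : T, «λ» (y * r) = ε r)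
    {n : ℕ} {c : T} (hc : c ∈ cohomologyAnnihilatorOfDegree T (n + 2)) :
    Ideal.Quotient.mk (Ideal.span {y}) c ∈ cohomologyAnnihilatorOfDegree (T ⧸ Ideal.span {y}) (n + 1) := by
  rw [mem_cohomologyAnnihilatorOfDegree_iff_forall_mem_extAnnihilatorFrom]
  intro Mbar hMbar
  haveI := hMbar
  -- restrict to `R♯` and take a free cover
  set M := (restrictScalarsFunctor T (T ⧸ Ideal.span {y})).obj Mbar with hM
  haveI : Module.Finite T M := finite_restrictScalars_of_surjective (algebraMap_quotient_surjective _) Mbar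
  obtain ⟨m, π, hπ⟩ := Module.Finite.exists_fin' T M
  set K₁ : Submodule T (Fin m → T) := LinearMap.ker π with hK₁
  haveI : Module.Finite T K₁ := Module.IsNoetherian.finite T _
  have hT := LinearMap.shortExact_shortComplexKer hπ
  have hsyz1 : IsSyzygy 1 M (ModuleCat.of T K₁) :=
    isSyzygy_one_iff.mpr ⟨ModuleCat.of T (Fin m → T), inferInstance,
      (IsProjective.iff_projective (R := T) (Fin m → T)).mp inferInstance, _, _, _, hT⟩
  have hregK₁ : IsSMulRegular (ModuleCat.of T K₁) y :=
    isSMulRegular_of_injective K₁.subtype Subtype.val_injective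
      (isSMulRegular_of_projective hy (ModuleCat.of T (Fin m → T))
        ((IsProjective.iff_projective (R := T) (Fin m → T)).mp inferInstance))
  -- an `n`-th syzygy `K` of `K₁` is an `(n+1)`-th syzygy of `M`: `c` stably annihilates it
  obtain ⟨K, hKfin, hK⟩ := exists_isSyzygy (ModuleCat.of T K₁) n
  haveI := hKfin
  have hKM : IsSyzygy (n + 1) M K := hsyz1.trans hK
  have hcK : StablyAnnihilates T c K :=
    (mem_cohomologyAnnihilatorOfDegree_succ_iff_forall_isSyzygy c).mp hc M K inferInstance hKM
  -- modulo `y`: `K/yK = Ωⁿ_{R̄}(K₁/yK₁)` and `c̄` stably annihilates it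
  obtain ⟨hKq, -⟩ := IsSyzygy.quotSMulTop hy hK hregK₁
  have hcKq := stablyAnnihilates_quotSMulTop y c hcK
  -- `c̄` kills `Ext^{≥ n+1}_{R̄}(K₁/yK₁, -)`
  have h1 : Ideal.Quotient.mk (Ideal.span {y}) c ∈
      extAnnihilatorFrom (ModuleCat.of (T ⧸ Ideal.span {y}) (K ⧸ (y • ⊤ : Submodule T K))) 1 := by
    rw [mem_extAnnihilatorFrom_iff]
    intro i hi N _ e
    exact hcKq.smul_ext_eq_zero N hi e
  have h2 := mem_extAnnihilatorFrom_of_isSyzygy n hKq h1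
  -- Knörrer (i): `M̄` is a retract of `K₁/yK₁`
  obtain ⟨i, r, hir⟩ := isRetract_quot_ker y ε «λ» hA1 hA2 Mbar π hπ
  rw [mem_extAnnihilatorFrom_iff] at h2 ⊢
  intro j hj N hN e
  exact ext_smul_eq_zero_of_retract i r hir _ (h2 j (by omega) N hN) e

/-- Ideal form: `(caⁿ⁺²(R♯)).map (R♯ → R♯/(y)) ≤ caⁿ⁺¹(R♯/(y))`. [OURS · L1 w44b] -/
theorem map_cohomologyAnnihilatorOfDegree_le [IsNoetherianRing T] {S : Type u} [CommRing S] [Algebra S T] {y : T} (hy : y ∈ T⁰)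
    (ε «λ» : T →ₗ[S] S) (hA1 : ∀ r : T, r - algebraMap S T (ε r) ∈ Ideal.span {y}) (hA2 : ∀ r : T, «λ» (y * r) = ε r) (n : ℕ) :
    (cohomologyAnnihilatorOfDegree T (n + 2)).map (Ideal.Quotient.mk (Ideal.span {y})) ≤
      cohomologyAnnihilatorOfDegree (T ⧸ Ideal.span {y}) (n + 1) := by
  rw [Ideal.map_le_iff_le_comap]
  intro c hc
  exact mk_mem_cohomologyAnnihilatorOfDegree hy ε «λ» hA1 hA2 hc

/-- `ca`-form: `(ca(R♯)).map (R♯ → R♯/(y)) ≤ ca(R♯/(y))`. [OURS · L1 w44b] -/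
theorem map_cohomologyAnnihilator_le [IsNoetherianRing T] {S : Type u} [CommRing S] [Algebra S T] {y : T} (hy : y ∈ T⁰)
    (ε «λ» : T →ₗ[S] S) (hA1 : ∀ r : T, r - algebraMap S T (ε r) ∈ Ideal.span {y}) (hA2 : ∀ r : T, «λ» (y * r) = ε r) :
    (cohomologyAnnihilator T).map (Ideal.Quotient.mk (Ideal.span {y})) ≤ cohomologyAnnihilator (T ⧸ Ideal.span {y}) := by
  rw [Ideal.map_le_iff_le_comap]
  intro c hc
  obtain ⟨n, hn⟩ := mem_cohomologyAnnihilator_iff.mp hc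
  exact cohomologyAnnihilatorOfDegree_le (n + 1)
    (mk_mem_cohomologyAnnihilatorOfDegree hy ε «λ» hA1 hA2 (cohomologyAnnihilatorOfDegree_mono (by omega) hn))

/-- With `y ∈ R♯⁰ ∩ ca(R♯)` (e.g. `2y = ∂_y(y² + f)`, char ≠ 2): **`(ca(R♯/(y))).comap = ca(R♯)`** — descent (this file) and ascent
(`QuotientAscent.comap_cohomologyAnnihilator_quotient_le`, p531707) together: the cohomology annihilator of the cover is EXACTLY the preimage
of that of the base. [OURS · L1 w44b] -/
theorem map_cohomologyAnnihilator_eq [IsNoetherianRing T] {S : Type u} [CommRing S] [Algebra S T] {y : T} (hy : y ∈ T⁰)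
    (ε «λ» : T →ₗ[S] S) (hA1 : ∀ r : T, r - algebraMap S T (ε r) ∈ Ideal.span {y}) (hA2 : ∀ r : T, «λ» (y * r) = ε r)
    (hcomap : (cohomologyAnnihilator (T ⧸ Ideal.span {y})).comap (Ideal.Quotient.mk (Ideal.span {y})) ≤ cohomologyAnnihilator T) :
    (cohomologyAnnihilator T).map (Ideal.Quotient.mk (Ideal.span {y})) = cohomologyAnnihilator (T ⧸ Ideal.span {y}) := by
  refine le_antisymm (map_cohomologyAnnihilator_le hy ε «λ» hA1 hA2) fun c hc => ?_
  obtain ⟨c', rfl⟩ := Ideal.Quotient.mk_surjective c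
  exact Ideal.mem_map_of_mem _ (hcomap (Ideal.mem_comap.mpr hc))

end Summit.ResolutionOfSingularities.ResolutionOfSingularities.Theorems.HomologicalConductor.DoubleCoverDescent

end
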